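import Summits.CriticalPhenomena.Ising3DConformalLimit.Theses.UnitLightCone
import HarnessLib

/-!
# Crux `UnitLightCone.LightConeRoundness` (stmt-CriticalPhenomena-17169) — negative-side support:
the Ising scaling-limit hypothesis is load-bearing

Standing crux disprover (cdisprove, cycle 1).  The crux (H1 `ρ > 0`; H2 `HasPointwiseScalingLimit
(criticalCorr 3) ρ S`; H3 normalisation; H4 non-degeneracy; H5 translation invariance; H6 scale covariance
with some `Δ : ℝ`; H7/H8 unit-cone Källén–Lehmann representations of `x ↦ S 2 (0,x)` in the frames `e₃` and
`(e₁+e₂)/√2` ⇒ two-point `O(3)` invariance) is a tree theorem WITHOUT H3, H7, H8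
(`UnitLightConeLightConeRoundness.lightConeRoundness_proof`, via `kernel_rotation_invariant`).  This file records
the complementary fact: H2 cannot be dropped, even keeping both light-cone representations.

* `LightConeRoundnessWithoutIsingLimit` — the crux with H1, H2 deleted (H3 ∧ H4 ∧ H5 ∧ H6 ∧ H7 ∧ H8 ⇒ roundness);
* `lightConeRoundness_false_without_isingLimit : ¬ LightConeRoundnessWithoutIsingLimit` — witness `blindFamily`:
  `Δ = 0`, two-point kernel `1` off the blind line `L = {x₃ = 0} ∩ {x₁ + x₂ = 0}`, `2` on `L ∖ {0}`, `0` at the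
  origin; both spectral measures the Dirac mass at `(k, ω) = (0,0)` (cone condition trivially met); the swap
  `x₂ ↔ x₃` moves `(1,-1,0) ∈ L` off `L`.  Neither frame sees `L` (`t = x₃ ≠ 0`, resp. `t = (x₁+x₂)/√2 ≠ 0`) and
  `Δ = 0` is admitted by the crux's binder.  What H2 supplies to any light-cone proof (line `birth`): the window
  `1/2 ≤ Δ ≤ 1`, continuity off `0`, and the nine lattice mirror symmetries (`twoPointKernelOfLimit_proof`).
-/

namespace Summit.CriticalPhenomena.Ising3DConformalLimit.Theorems.LightConeRoundness.Negative

open Literature.Probability.LatticeModels MeasureTheory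

/-- The crux with the Ising-limit hypotheses H1, H2 DROPPED: the model-blind statement "a normalised,
non-degenerate, translation-invariant, scale-covariant (some `Δ : ℝ`) family whose two-point kernel has
unit-cone Källén–Lehmann representations in the frames `e₃` and `(e₁+e₂)/√2` has a round two-point kernel".
It is the crux verbatim with the binder `ρ` and the hypotheses H1, H2 removed.
FALSE: `lightConeRoundness_false_without_isingLimit`. -/
def LightConeRoundnessWithoutIsingLimit : Prop :=
  ∀ (Δ : ℝ) (S : CorrFamily 3), (∀ n z, z ∉ NonCoincident 3 n → S n z = 0) →
    IsNondegenerateTwoPoint S → IsTranslationInvariant S → IsScaleCovariant Δ S →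
    (∃ μ : Measure (EuclideanSpace ℝ (Fin 2) × ℝ), μ {p : EuclideanSpace ℝ (Fin 2) × ℝ | p.2 < ‖p.1‖} = 0 ∧
      (∀ t a b : ℝ, t ≠ 0 → (fun x : EuclideanSpace ℝ (Fin 3) => S 2 ![0, x])
        (EuclideanSpace.single 0 a + EuclideanSpace.single 1 b + EuclideanSpace.single 2 t) =
        ∫ p, Real.cos (p.1 0 * a + p.1 1 * b) * Real.exp (-(p.2 * |t|)) ∂μ)) →
    (∃ μ : Measure (EuclideanSpace ℝ (Fin 2) × ℝ), μ {p : EuclideanSpace ℝ (Fin 2) × ℝ | p.2 < ‖p.1‖} = 0 ∧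
      (∀ t u v : ℝ, t ≠ 0 → (fun x : EuclideanSpace ℝ (Fin 3) => S 2 ![0, x])
        (EuclideanSpace.single 0 ((t + u) / Real.sqrt 2) + EuclideanSpace.single 1 ((t - u) / Real.sqrt 2) +
          EuclideanSpace.single 2 v) =
        ∫ p, Real.cos (p.1 0 * u + p.1 1 * v) * Real.exp (-(p.2 * |t|)) ∂μ)) →
    ∀ (R : EuclideanSpace ℝ (Fin 3) ≃ₗᵢ[ℝ] EuclideanSpace ℝ (Fin 3)) (x : EuclideanSpace ℝ (Fin 3)),
      S 2 ![0, R x] = S 2 ![0, x]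

/-- The blind-line kernel: `0` at the origin, `2` on the line `{x₃ = 0, x₁ + x₂ = 0}` minus the origin,
`1` elsewhere.  Homogeneous of degree `0`, not round. -/
noncomputable def blindKernel (x : EuclideanSpace ℝ (Fin 3)) : ℝ :=
  if x = 0 then 0 else if x 2 = 0 ∧ x 0 + x 1 = 0 then 2 else 1

/-- The witness family: `S 2 (y, z) = blindKernel (z - y)`, all other `S n = 0`. -/
noncomputable def blindFamily : CorrFamily 3
  | 2 => fun z => blindKernel (z 1 - z 0)
  | _ => fun _ => 0

/-- The two-point entry of the witness family. -/
@[simp] theorem blindFamily_two (z : Fin 2 → EuclideanSpace ℝ (Fin 3)) :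
    blindFamily 2 z = blindKernel (z 1 - z 0) := rfl

/-- Every entry of the witness family other than the two-point one vanishes. -/
theorem blindFamily_ne_two {n : ℕ} (hn : n ≠ 2) (z : Fin n → EuclideanSpace ℝ (Fin 3)) :
    blindFamily n z = 0 := by
  match n, hn with
  | 0, _ => rfl
  | 1, _ => rfl
  | 2, h => exact absurd rfl h
  | _ + 3, _ => rfl

/-- The blind-line kernel vanishes at the origin. -/
theorem blindKernel_zero : blindKernel 0 = 0 := by simp [blindKernel]

/-- The blind-line kernel is positive off the origin. -/
theorem blindKernel_pos {x : EuclideanSpace ℝ (Fin 3)} (hx : x ≠ 0) : 0 < blindKernel x := by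
  unfold blindKernel
  rw [if_neg hx]
  split_ifs <;> norm_num

/-- Off the plane `{x₃ = 0}` (the region seen by the axis frame `e₃`) the kernel equals `1`. -/
theorem blindKernel_of_apply_two_ne {x : EuclideanSpace ℝ (Fin 3)} (hx : x 2 ≠ 0) : blindKernel x = 1 := by
  have hx0 : x ≠ 0 := fun h => hx (by simp [h])
  unfold blindKernel
  rw [if_neg hx0, if_neg fun h => hx h.1]

/-- Off the plane `{x₁ + x₂ = 0}` (the region seen by the diagonal frame) the kernel equals `1`. -/
theorem blindKernel_of_sum_ne {x : EuclideanSpace ℝ (Fin 3)} (hx : x 0 + x 1 ≠ 0) : blindKernel x = 1 := by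
  have hx0 : x ≠ 0 := fun h => hx (by simp [h])
  unfold blindKernel
  rw [if_neg hx0, if_neg fun h => hx h.2]

/-- The blind-line kernel is homogeneous of degree `0`. -/
theorem blindKernel_smul {c : ℝ} (hc : c ≠ 0) (x : EuclideanSpace ℝ (Fin 3)) :
    blindKernel (c • x) = blindKernel x := by
  have h0 : c • x = 0 ↔ x = 0 := smul_eq_zero_iff_right hc
  have h2 : (c • x) 2 = 0 ↔ x 2 = 0 := by simp [hc]
  have h01 : (c • x) 0 + (c • x) 1 = 0 ↔ x 0 + x 1 = 0 := by
    simp only [PiLp.smul_apply, smul_eq_mul, ← mul_add, mul_eq_zero, hc, false_or]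
  unfold blindKernel
  simp only [h0, h2, h01]

/-- H3 for the witness: it vanishes off the non-coincident configurations. -/
theorem blindFamily_normalised : ∀ n z, z ∉ NonCoincident 3 n → blindFamily n z = 0 := by
  intro n z hz
  by_cases hn : n = 2
  · subst hn
    rw [blindFamily_two]
    have h10 : z 1 - z 0 = 0 := by
      rw [mem_nonCoincident, Function.Injective] at hz
      push Not at hz
      obtain ⟨i, j, hij, hne⟩ := hz
      fin_cases i <;> fin_cases j
      · exact absurd rfl hne
      · simpa [sub_eq_zero] using hij.symm
      · simpa [sub_eq_zero] using hij
      · exact absurd rfl hne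
    rw [h10, blindKernel_zero]
  · exact blindFamily_ne_two hn z

/-- H4 for the witness: the two-point function is positive off the diagonal. -/
theorem blindFamily_nondegenerate : IsNondegenerateTwoPoint blindFamily := by
  intro z hz
  rw [mem_nonCoincident] at hz
  rw [blindFamily_two]
  refine blindKernel_pos fun h => ?_
  have h10 : z 1 = z 0 := sub_eq_zero.mp h
  exact absurd (hz h10) (by decide)

/-- H5 for the witness: translation invariance. -/
theorem blindFamily_translationInvariant : IsTranslationInvariant blindFamily := by
  intro n v z
  by_cases hn : n = 2
  · subst hn
    simp only [blindFamily_two, add_sub_add_right_eq_sub]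
  · simp [blindFamily_ne_two hn]

/-- H6 for the witness, with `Δ = 0`. -/
theorem blindFamily_scaleCovariant : IsScaleCovariant 0 blindFamily := by
  intro n c hc z
  have h1 : c ^ (-(n : ℝ) * 0) = 1 := by rw [mul_zero, Real.rpow_zero]
  rw [h1, one_mul]
  by_cases hn : n = 2
  · subst hn
    simp only [blindFamily_two]
    rw [← smul_sub, blindKernel_smul hc.ne']
  · simp [blindFamily_ne_two hn]

/-- The Dirac mass at `(k, ω) = (0, 0)`: the common Källén–Lehmann measure of the witness in both frames. -/
noncomputable def diracZero : Measure (EuclideanSpace ℝ (Fin 2) × ℝ) :=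
  Measure.dirac ((0 : EuclideanSpace ℝ (Fin 2)), (0 : ℝ))

/-- The Dirac mass at `(0,0)` gives no weight to the spacelike region `{ω < ‖k‖}`. -/
theorem diracZero_cone : diracZero {p : EuclideanSpace ℝ (Fin 2) × ℝ | p.2 < ‖p.1‖} = 0 := by
  rw [diracZero, Measure.dirac_apply]
  exact Set.indicator_of_notMem (by simp) _

/-- The Källén–Lehmann integral against the Dirac mass at `(0,0)` is identically `1`. -/
theorem integral_diracZero (a b t : ℝ) :
    ∫ p, Real.cos (p.1 0 * a + p.1 1 * b) * Real.exp (-(p.2 * |t|)) ∂diracZero = 1 := by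
  rw [diracZero, integral_dirac]
  simp

/-- H7 for the witness: unit-cone Källén–Lehmann representation in the axis frame `e₃`. -/
theorem blindFamily_axisConeKL :
    ∃ μ : Measure (EuclideanSpace ℝ (Fin 2) × ℝ), μ {p : EuclideanSpace ℝ (Fin 2) × ℝ | p.2 < ‖p.1‖} = 0 ∧
      (∀ t a b : ℝ, t ≠ 0 → (fun x : EuclideanSpace ℝ (Fin 3) => blindFamily 2 ![0, x])
        (EuclideanSpace.single 0 a + EuclideanSpace.single 1 b + EuclideanSpace.single 2 t) =
        ∫ p, Real.cos (p.1 0 * a + p.1 1 * b) * Real.exp (-(p.2 * |t|)) ∂μ) := by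
  refine ⟨diracZero, diracZero_cone, fun t a b ht => ?_⟩
  rw [integral_diracZero]
  simp only [blindFamily_two, Matrix.cons_val_one, Matrix.cons_val_zero, sub_zero]
  apply blindKernel_of_apply_two_ne
  simpa using ht

/-- H8 for the witness: unit-cone Källén–Lehmann representation in the diagonal frame `(e₁+e₂)/√2`. -/
theorem blindFamily_diagConeKL :
    ∃ μ : Measure (EuclideanSpace ℝ (Fin 2) × ℝ), μ {p : EuclideanSpace ℝ (Fin 2) × ℝ | p.2 < ‖p.1‖} = 0 ∧
      (∀ t u v : ℝ, t ≠ 0 → (fun x : EuclideanSpace ℝ (Fin 3) => blindFamily 2 ![0, x])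
        (EuclideanSpace.single 0 ((t + u) / Real.sqrt 2) + EuclideanSpace.single 1 ((t - u) / Real.sqrt 2) +
          EuclideanSpace.single 2 v) =
        ∫ p, Real.cos (p.1 0 * u + p.1 1 * v) * Real.exp (-(p.2 * |t|)) ∂μ) := by
  refine ⟨diracZero, diracZero_cone, fun t u v ht => ?_⟩
  rw [integral_diracZero]
  simp only [blindFamily_two, Matrix.cons_val_one, Matrix.cons_val_zero, sub_zero]
  apply blindKernel_of_sum_ne
  have h2 : Real.sqrt 2 ≠ 0 := Real.sqrt_ne_zero'.mpr two_pos
  have hsum : (t + u) / Real.sqrt 2 + (t - u) / Real.sqrt 2 = 2 * t / Real.sqrt 2 := by ring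
  simp only [PiLp.add_apply, PiLp.single_apply]
  simp only [Fin.isValue, ↓reduceIte, Fin.zero_eq_one_iff, OfNat.ofNat_ne_one, Fin.reduceEq, add_zero,
    Fin.one_eq_zero_iff, zero_add]
  rw [hsum]
  exact div_ne_zero (mul_ne_zero two_ne_zero ht) h2

/-- **H2 is load-bearing.**  The crux with the Ising scaling-limit hypothesis dropped is false: the blind-line
family (`Δ = 0`) satisfies H3–H8 and its two-point kernel is not invariant under the swap `x₂ ↔ x₃`. -/
theorem lightConeRoundness_false_without_isingLimit : ¬ LightConeRoundnessWithoutIsingLimit := by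
  intro h
  have key := h 0 blindFamily blindFamily_normalised blindFamily_nondegenerate blindFamily_translationInvariant
    blindFamily_scaleCovariant blindFamily_axisConeKL blindFamily_diagConeKL
    (LinearIsometryEquiv.piLpCongrLeft 2 ℝ ℝ (Equiv.swap (1 : Fin 3) 2))
    (EuclideanSpace.single 0 1 - EuclideanSpace.single 1 1)
  simp only [blindFamily_two, Matrix.cons_val_one, Matrix.cons_val_zero, sub_zero, map_sub,
    LinearIsometryEquiv.piLpCongrLeft_single] at key
  have hL : blindKernel (EuclideanSpace.single 0 1 - EuclideanSpace.single 1 1) = 2 := by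
    have hne : (EuclideanSpace.single 0 1 - EuclideanSpace.single 1 1 : EuclideanSpace ℝ (Fin 3)) ≠ 0 := by
      intro h0
      have := congrArg (fun x : EuclideanSpace ℝ (Fin 3) => x 0) h0
      simp at this
    unfold blindKernel
    rw [if_neg hne, if_pos]
    simp
  have hR : blindKernel (EuclideanSpace.single ((Equiv.swap (1 : Fin 3) 2) 0) 1 -
      EuclideanSpace.single ((Equiv.swap (1 : Fin 3) 2) 1) 1) = 1 := by
    apply blindKernel_of_apply_two_ne
    simp [Equiv.swap_apply_of_ne_of_ne]
  rw [hL, hR] at key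
  norm_num at key

end Summit.CriticalPhenomena.Ising3DConformalLimit.Theorems.LightConeRoundness.Negative
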